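import Mathlib
import Summits.ValiantsHypothesis.ValiantsHypothesis.Theses.ValuativeGCT
import Summits.ValiantsHypothesis.ValiantsHypothesis.Theorems.ValuativeGCTValuativeFlipOddDegreeBite

/-!
# `ValuativeGCT.ValuativeFlip` (stmt-ValiantsHypothesis-12624), det census — THE VALUATIVE LEVER BITES AT EVERY
# `(m, δ)` WITH `m ≥ 3`, `δ ≥ 2`, IN THE CRUX'S OWN CURRENCY

Packaging of `evenDegree_admissibleCentre_bites` (powers of the first-rung witness) and `oddDegree_bite_of_mem`
(order-one witnesses) over the admissible corner centre `Λ_3 ⊕ D_{m-3}` (`cornerCentre_rank_le`, `r = m - 1`):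

* `oddDegree_admissibleCentre_bites` — `m ≥ 3`, `k ≥ 1`: an admissible centre `(U, r)` and `λ ⊢ m (2k+1)` with
  `finrank T_U((2k+1)(m-r), λ*) < finrank T_U(0, λ*)`;
* `allDegrees_admissibleCentre_bites` — for every `m ≥ 3` and EVERY degree `δ ≥ 2` there are an admissible centre
  `(U, r)` (rank `≤ r` on `U`, `r < m`) and `λ ⊢ m δ` (`≤ m²` parts) with `finrank T_U(δ(m-r), λ*) < finrank T_U(0, λ*)`:
  the route's det-side lever is non-vacuous at every size in every degree but `δ = 1` (where no singular centre can
  bite: the degree-`m` explicit invariants are the level-1 blow-ups `det(Σ a_j X_j)`, all vanishing on `L_U`).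

References: BLMW, SIAM J. Comput. 40 (2011) §5.2; M. Domokos, A. N. Zubkov, Transform. Groups 6 (2001) Thm. 1.1.
-/

namespace Summit.ValiantsHypothesis.ValiantsHypothesis.Theorems.ValuativeFlip

open Literature.NumberTheory.DiophantineGeometry Literature.Computability.AlgebraicComplexity
open MvPolynomial
open scoped BigOperators Matrix

-- `Summit.ValiantsHypothesis.ValiantsHypothesis.…` is the tree's mandated single-conjunct layout (Sub = Summit).
set_option linter.dupNamespace false

noncomputable section

/-- **Odd degrees in the crux's currency.**  For every `m ≥ 3` and `k ≥ 1` there are an admissible centre `(U, r)` —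
the corner centre `Λ_3 ⊕ D_{m-3}`, `r = m - 1` — and `λ ⊢ m (2k+1)` (`≤ m²` parts) with
`finrank T_U((2k+1)(m-r), λ*) < finrank T_U(0, λ*)` (degree `m (2k+1)`, threshold `2k+1 ≥ 3`). [folklore] -/
theorem oddDegree_admissibleCentre_bites (m : ℕ) (h3 : 3 ≤ m) (k : ℕ) (hk : 1 ≤ k) :
    ∃ (U : Submodule ℂ (MatIdx m → ℂ)) (r : ℕ),
      (∀ u ∈ U, (Matrix.of fun a b : Fin m => u (toLex (a, b))).rank ≤ r) ∧ r < m ∧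
      ∃ lam : Nat.Partition (m * (2 * k + 1)), lam.parts.card ≤ m * m ∧
      (let χ : Weight (MatIdx m) := (Weight.dualOfPartition (m * m) lam).toMatIdx;
      let T : ℕ → Submodule ℂ (MvPolynomial (MatIdx m × MatIdx m) ℂ) := fun t =>
        MvPolynomial.homogeneousSubmodule (MatIdx m × MatIdx m) ℂ (m * (2 * k + 1))
        ⊓ ((MvPolynomial.vanishingIdeal ℂ {p : MatIdx m × MatIdx m → ℂ |
              ∀ j : MatIdx m, (fun i => p (j, i)) ∈ U}) ^ (t)).restrictScalars ℂ
        ⊓ (⨅ (M : Matrix (MatIdx m) (MatIdx m) ℂ)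
            (_ : linSubst (MatIdx m) ℂ M (detFormLex ℂ m) = detFormLex ℂ m),
            LinearMap.ker ((MvPolynomial.aeval (R := ℂ) fun p : MatIdx m × MatIdx m =>
              ∑ l : MatIdx m, M l p.2 • MvPolynomial.X (p.1, l)).toLinearMap
              - LinearMap.id (R := ℂ) (M := MvPolynomial (MatIdx m × MatIdx m) ℂ)))
        ⊓ (⨅ (g : Matrix.GeneralLinearGroup (MatIdx m) ℂ) (_ : IsUpperTriangular g),
            LinearMap.ker ((MvPolynomial.aeval (R := ℂ) fun p : MatIdx m × MatIdx m =>
              ∑ l : MatIdx m, ((g⁻¹ : Matrix.GeneralLinearGroup (MatIdx m) ℂ) :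
                Matrix (MatIdx m) (MatIdx m) ℂ) p.1 l • MvPolynomial.X (l, p.2)).toLinearMap
              - weightChar χ g • LinearMap.id (R := ℂ) (M := MvPolynomial (MatIdx m × MatIdx m) ℂ)));
      Module.finrank ℂ ↥(T ((2 * k + 1) * (m - r))) < Module.finrank ℂ ↥(T 0)) := by
  obtain ⟨n, rfl⟩ := Nat.exists_eq_add_of_le h3
  have hA : ∀ (A : Matrix (Fin 3) (Fin 3) ℂ), Aᵀ = -A → ∀ i j, A i j = -A j i := fun A hA i j => by
    have := congr_fun (congr_fun hA j) i
    simpa only [Matrix.transpose_apply, Matrix.neg_apply] using this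
  have h0 : ∀ i j : Fin n, i ≠ j → (0 : Matrix (Fin n) (Fin n) ℂ) i j = 0 := fun _ _ _ => rfl
  have h1 : ∀ i j : Fin n, i ≠ j → (1 : Matrix (Fin n) (Fin n) ℂ) i j = 0 := fun _ _ h => Matrix.one_apply_ne h
  have hz : ∀ i j : Fin 3, (0 : Matrix (Fin 3) (Fin 3) ℂ) i j = -(0 : Matrix (Fin 3) (Fin 3) ℂ) j i := by simp
  obtain ⟨lam, hcard, hlt⟩ := oddDegree_bite_of_mem finSumFinEquiv (1 : Matrix (Fin n) (Fin n) ℂ)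
    (by rw [Matrix.det_one]; exact one_ne_zero) _
    (frc_mem_cornerCentre (hA _ frc_sP_transpose) h0) (frc_mem_cornerCentre (hA _ frc_sQ_transpose) h0)
    (frc_mem_cornerCentre (hA _ frc_sR_transpose) h0) (frc_mem_cornerCentre hz h1) k
  refine ⟨_, 3 + n - 1, cornerCentre_rank_le n, by omega, lam, hcard, ?_⟩
  have h2 : (2 * k + 1) * (3 + n - (3 + n - 1)) = 2 * k + 1 := by
    rw [show 3 + n - (3 + n - 1) = 1 by omega, mul_one]
  dsimp only
  rw [h2]
  exact hlt (2 * k + 1) (by omega)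

/-- **THE VALUATIVE LEVER BITES AT EVERY `(m, δ)`, `m ≥ 3`, `δ ≥ 2`.**  For every `m ≥ 3` and every degree `δ ≥ 2`
there are an admissible centre `(U, r)` of the crux `ValuativeFlip` (rank `≤ r` on `U`, `r < m`) and a shape
`λ ⊢ m δ` (`≤ m²` parts) whose valuative truncation at the crux's threshold `δ (m - r)` is STRICTLY smaller than the
census space: `finrank T_U(δ(m-r), λ*) < finrank T_U(0, λ*)` (even `δ`: `evenDegree_admissibleCentre_bites`; odd
`δ ≥ 3`: `oddDegree_admissibleCentre_bites`; centre `Λ_3 ⊕ D_{m-3}` in both cases). [folklore] -/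
theorem allDegrees_admissibleCentre_bites (m : ℕ) (h3 : 3 ≤ m) (δ : ℕ) (hδ : 2 ≤ δ) :
    ∃ (U : Submodule ℂ (MatIdx m → ℂ)) (r : ℕ),
      (∀ u ∈ U, (Matrix.of fun a b : Fin m => u (toLex (a, b))).rank ≤ r) ∧ r < m ∧
      ∃ lam : Nat.Partition (m * δ), lam.parts.card ≤ m * m ∧
      (let χ : Weight (MatIdx m) := (Weight.dualOfPartition (m * m) lam).toMatIdx;
      let T : ℕ → Submodule ℂ (MvPolynomial (MatIdx m × MatIdx m) ℂ) := fun t =>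
        MvPolynomial.homogeneousSubmodule (MatIdx m × MatIdx m) ℂ (m * δ)
        ⊓ ((MvPolynomial.vanishingIdeal ℂ {p : MatIdx m × MatIdx m → ℂ |
              ∀ j : MatIdx m, (fun i => p (j, i)) ∈ U}) ^ (t)).restrictScalars ℂ
        ⊓ (⨅ (M : Matrix (MatIdx m) (MatIdx m) ℂ)
            (_ : linSubst (MatIdx m) ℂ M (detFormLex ℂ m) = detFormLex ℂ m),
            LinearMap.ker ((MvPolynomial.aeval (R := ℂ) fun p : MatIdx m × MatIdx m =>
              ∑ l : MatIdx m, M l p.2 • MvPolynomial.X (p.1, l)).toLinearMap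
              - LinearMap.id (R := ℂ) (M := MvPolynomial (MatIdx m × MatIdx m) ℂ)))
        ⊓ (⨅ (g : Matrix.GeneralLinearGroup (MatIdx m) ℂ) (_ : IsUpperTriangular g),
            LinearMap.ker ((MvPolynomial.aeval (R := ℂ) fun p : MatIdx m × MatIdx m =>
              ∑ l : MatIdx m, ((g⁻¹ : Matrix.GeneralLinearGroup (MatIdx m) ℂ) :
                Matrix (MatIdx m) (MatIdx m) ℂ) p.1 l • MvPolynomial.X (l, p.2)).toLinearMap
              - weightChar χ g • LinearMap.id (R := ℂ) (M := MvPolynomial (MatIdx m × MatIdx m) ℂ)));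
      Module.finrank ℂ ↥(T (δ * (m - r))) < Module.finrank ℂ ↥(T 0)) := by
  rcases Nat.even_or_odd δ with ⟨k, hk⟩ | ⟨k, hk⟩
  · rw [← two_mul] at hk
    subst hk
    exact evenDegree_admissibleCentre_bites m h3 k (by omega)
  · subst hk
    exact oddDegree_admissibleCentre_bites m h3 k (by omega)

end

end Summit.ValiantsHypothesis.ValiantsHypothesis.Theorems.ValuativeFlip
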